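import Literature.Computability.Complexity.CodeFPArith
import Literature.Algebra.EuclideanLattices.Encoding
import HarnessLib

/-!
# A polynomial-time computable function of a unary numeral is computed on codes (`CodeFP unE`)

Topic `Computability/Complexity`, a bridge between the two polynomial-time notions of the tree:
`PolyTimeComputable ea eb f` (`TimeBounds.lean`: SOME machine computes `eb (f a)` on the code `ea a`
within a polynomial time bound — nothing is said off the image of `ea`) and `CodeFP eα eβ g`
(`CodeFP.lean`: some TOTAL polynomial-time string function `F ∈ FP` has `F (eα a) = eβ (g a)`).
`CodeFP → PolyTimeComputable` is `CodeFP.polyTimeComputable`; the converse needs a clock in general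
(the machine may diverge off codes). For the UNARY input code it does not: every string `w` is turned
into the unary numeral `1^{|w|}` in polynomial time (`strLength`), the machine of `f` is run on that
code — where it halts in time with the right output — and the composite string function is total, in
`FP`, and agrees with `eb ∘ f` on `1ⁿ` (`|1ⁿ| = n`).

* **`CodeFP.ofPolyTimeComputable_unE`** — `PolyTimeComputable unE eb f → CodeFP unE eb f`;
* `CodeFP.codeFP_natParam`, `CodeFP.codeFP_ratParam` — how a uniform reduction consumes the hypothesis
  `IsPolyTimeParams q α m` of the LWE trunk (`Cryptography/LWEHardness.lean`: `q`, `m` and the rational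
  `α` are `PolyTimeComputable` from `1ⁿ`, the latter through `encodeRat`).

## References

* S. Arora, B. Barak, *Computational Complexity: A Modern Approach*, CUP 2009, §1.3 (composition of
  polynomial-time machines; unary inputs) [AroraBarak2009].
-/

namespace Literature.Computability.Complexity

namespace CodeFP

open _root_.Computability

variable {β : Type}

/-- **A polynomial-time computable function of a unary numeral is computed on codes.** From a machine
computing `eb (f n)` on `1ⁿ` in polynomial time, the TOTAL string function `w ↦ eb (f |w|)` is in `FP`
(sanitise `w ↦ 1^{|w|}`, then run the machine — on a genuine unary code) and agrees with `eb ∘ f` on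
`1ⁿ`. [cite: AroraBarak2009, §1.3] -/
theorem ofPolyTimeComputable_unE {eb : β → List Bool} {f : ℕ → β} (h : PolyTimeComputable unE eb f) :
    CodeFP unE eb f := by
  -- `w ↦ 1^{|w|}` computes `List.length` from `id`-coded strings to `unE`-coded naturals
  obtain ⟨S, ⟨p₁, M₁, hM₁⟩, hSlen⟩ := (strLength : CodeFP strE unE List.length)
  have hlen : PolyTimeComputable (id : List Bool → List Bool) unE List.length := by
    refine ⟨p₁, M₁, fun w => ?_⟩
    have h₁ := hM₁ w
    have hS : (id (S w) : List Bool) = unE w.length := hSlen w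
    rwa [hS] at h₁
  -- compose with the machine of `f`: total, computes `eb (f |w|)` on every `w`
  have hcomp : PolyTimeComputable (id : List Bool → List Bool) eb (f ∘ List.length) :=
    PolyTimeComputable.comp_holds h hlen
  refine ⟨fun w => eb (f w.length), ?_, fun n => by simp⟩
  obtain ⟨p, M, hM⟩ := hcomp
  exact ⟨p, M, fun w => hM w⟩

/-- **A `PolyTimeComputable unaryEncodeNat encodeNat` parameter is `CodeFP unE natE`** (e.g. the
modulus `q` of `IsPolyTimeParams`). [cite: AroraBarak2009, §1.3] -/
theorem codeFP_natParam {q : ℕ → ℕ} (h : PolyTimeComputable unaryEncodeNat encodeNat q) : CodeFP unE natE q :=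
  ofPolyTimeComputable_unE h

/-- **A `PolyTimeComputable unaryEncodeNat encodeRat` rational parameter is computed on codes**, read as
the pair (numerator in sign–magnitude, denominator in binary) of its reduced fraction (e.g. the
rational noise rate `a` of `IsPolyTimeParams`). [cite: AroraBarak2009, §1.3] -/
theorem codeFP_ratParam {a : ℕ → ℚ}
    (h : PolyTimeComputable unaryEncodeNat Literature.Algebra.EuclideanLattices.encodeRat a) :
    CodeFP unE (pairE smE natE) (fun n => ((a n).num, (a n).den)) := by
  have h' : CodeFP unE Literature.Algebra.EuclideanLattices.encodeRat a := ofPolyTimeComputable_unE h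
  exact h'.recodeOut fun n => rfl

end CodeFP

end Literature.Computability.Complexity
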